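import Summits.AnomalousDissipation.AnomalousDissipation.Theorems.BaireTransferRobustLoudUpgradeLine
import Summits.AnomalousDissipation.AnomalousDissipation.Theorems.BaireTransferRobustLoudUpgradeStubSteadyPersist
import Summits.AnomalousDissipation.AnomalousDissipation.Theorems.BaireTransferRobustLoudUpgradeStubPeriodicWindow
import Summits.AnomalousDissipation.AnomalousDissipation.Theorems.BaireTransferRobustLoudUpgradePeriodicPersistOfHenry
import Literature.Analysis.FluidPDE.PeriodicNSOrbitPersistsProofs
import Literature.Analysis.FluidPDE.LongTimeAverageNonneg
import Literature.Topology.FortLowerHemicontinuity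
import Summits.AnomalousDissipation.AnomalousDissipation.Theorems.BaireTransferRobustLoudUpgradeStubWindowExhaust
import Summits.AnomalousDissipation.AnomalousDissipation.Theorems.BaireTransferRobustLoudUpgradeStubOrbitInW
import Summits.AnomalousDissipation.AnomalousDissipation.Theorems.BaireTransferRobustLoudUpgradeStubLimitEquation
import Summits.AnomalousDissipation.AnomalousDissipation.Theorems.BaireTransferRobustLoudUpgradeStubRealizeTempered
import Summits.AnomalousDissipation.AnomalousDissipation.Theorems.BaireTransferRobustLoudUpgradeStubBudgetLimit
import Summits.AnomalousDissipation.AnomalousDissipation.Theorems.BaireTransferRobustLoudUpgradeTemperedClosed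
import Summits.AnomalousDissipation.AnomalousDissipation.Theorems.BaireTransferRobustLoudUpgradeLoudCategory
import Summits.AnomalousDissipation.AnomalousDissipation.Theorems.BaireTransferRobustLoudUpgradeStubCorrRange
import Summits.AnomalousDissipation.AnomalousDissipation.Theorems.BaireTransferRobustLoudUpgradeStubCorrGraphClosed
import Summits.AnomalousDissipation.AnomalousDissipation.Theorems.BaireTransferRobustLoudUpgradeStubWindowExhaust2
import Summits.AnomalousDissipation.AnomalousDissipation.Theorems.BaireTransferRobustLoudUpgradeStubLhcInterior

/-!
# Line `malkin-cone-group-orbits`, skeleton c16 v5 (lead `…-1144-c16-0`) for the crux `BaireTransfer.RobustLoudUpgrade`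
# (stmt-AnomalousDissipation-1144): LATTICE-TEMPERED WINDOWS — the census's split D5 made unconditional; `loud` is `F_σ`;
# category + GENERIC PERSISTENCE for ALL witnesses.  ONE sorry: the residual `stub_residual_c16` ≡ crux.

The crux-strategist's census v3 (`Cruxes/RobustLoudUpgrade/STRATEGY-CENSUS.md` §D5) reduces the crux to THREE pieces:
`TemperedClosed → WindowExhaust → LocallyNonMeagreLoud → RobustLoudUpgrade` (+ converse in the Baire space `P_S`).  THIS SKELETON cuts the
windows on the SPACE–TIME FOURIER LATTICE `ℤ × ℤ³` of the orbit (`û = 𝓕(timeRoll τ u − mean)`): `ν ∈ [ν₁,ν₂]`, `τ ∈ [τ₁,τ₂]`, `‖mean‖ ≤ H`,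
parabolic moment `Σ Λ(n,k)³ ‖û(n,k)‖² ≤ H` (`Λ = |n| + |k|²`), and EVERYTHING except the residual is LANDED:

* Sub₀ `stub_windowExhaust` p161161; Sub₁ = `stub_orbitInW` p161083 + `stub_limitEquation` p161385 + `stub_realizeTempered` p161460 +
  `stub_budgetLimit` p161396 + the lead's assembly `stub_temperedClosed` = `Tempered.isClosed_latticeWindow` p162128 (`…TemperedClosed.lean`,
  with `exists_isClosed_iUnion_eq_loud`: **`loud S a E ε` is `F_σ`**);
* consequences p162578 (`…LoudCategory.lean`): `isMeagre_loud_diff_interior` (the upgrade holds off a MEAGRE set for ALL witnesses, sharp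
  budgets, interior), `crux_iff_locallyNonMeagreLoud` (census D5 both ways, unconditional), `baireTarget_iff_locallyNonMeagre`, and the route
  door R5 `all_loud_of_denseLatticeTempered` / `baireTarget_of_denseLatticeTempered` (unconditional);
* cycle 2, GENERIC PERSISTENCE FOR ALL WITNESSES: `stub_corrRange` p163349, `stub_corrGraphClosed` p163561, `stub_windowExhaust2` p163319,
  `stub_lhcInterior` p163611 and the lead's Fort assembly `stub_genericPeriodic` = `Tempered.genericPeriodic_interior` p164139
  (`…CategoryPeriodicGeneric.lean`: a residual budget-free `G(S)` on which every strictly-loud classical periodic witness makes `c` interior;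
  `crux_residual_subset_compl_generic`: every counterexample force is NON-GENERIC); `…CategoryGenericRescaling.lean` p164480: generic
  rescalings settle the crux at a force; `…CategoryGenericDoor.lean` p165359: door R7 — GENERIC dense loud designer forces ⇒ `BaireTarget`.
* Sub₂, the residual `stub_residual_c16` (relaxed loudness is non-meagre near every loud force), is the crux in Baire-largeness language
  (`Tempered.crux_iff_locallyNonMeagreLoud`) — registered, honest, crux-hard (census W1/W4).

Composition `RobustLoudUpgrade_of` (sorry-free): windows are closed (Sub₁) and exhaust the relaxed loud set (Sub₀), so `LOUD_j(S,2E,ε/2)` is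
`F_σ`; an `F_σ` set non-meagre in every neighbourhood of `c` has `c` in the closure of its interior (`mem_closure_interior_of_not_isMeagre`).
-/

set_option linter.dupNamespace false

noncomputable section

open scoped BigOperators Topology ENNReal NNReal ComplexConjugate
open Filter Set Function TopologicalSpace MeasureTheory UnitAddTorus

namespace Summit.AnomalousDissipation.AnomalousDissipation.Theorems.RobustLoudUpgrade.Tempered

open Literature.Analysis.FunctionSpaces Literature.Analysis.FunctionSpaces.Torus
open Literature.Analysis.FunctionSpaces.EuclideanSpace
open Literature.Analysis.FluidPDE Literature.Analysis.FluidPDE.ScalarFourier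
open Literature.Analysis.FluidPDE.TimePeriodicLattice
open Summit.AnomalousDissipation.AnomalousDissipation.Theses.BaireTransfer
open Summit.AnomalousDissipation.AnomalousDissipation.Theorems.RobustLoudUpgrade

-- NOTATION START (verbatim the local notations of `Literature/Analysis/FluidPDE/PeriodicNSOrbitPersistsProofs.lean`)
/-- The flat unit torus `T³`. -/
local notation "𝕋³" => UnitAddTorus (Fin 3)
/-- Real velocity values. -/
local notation "ℝ³" => EuclideanSpace ℝ (Fin 3)
/-- Complex coefficient values. -/
local notation "ℂ³" => EuclideanSpace ℂ (Fin 3)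

/-- Local notation: the parabolic weight `Λ(n, k) = |n| + |k|²`. -/
local notation:max "Λ" m:max => (|((Prod.fst m : ℤ) : ℝ)| + freqNormSq (Prod.snd m))

/-- Local notation: the convective symbol on `ℤ × ℤ³` (as in `TimePeriodicNSLattice`). -/
local notation:max "𝐍[" a ", " b "]" m:max =>
  (WithLp.toLp 2 (fun p : Fin 3 => ∑ j : Fin 3, ∑' m' : ℤ × (Fin 3 → ℤ),
    a m' j * (dsym j (Prod.snd m - Prod.snd m') * b (m - m') p)) : EuclideanSpace ℂ (Fin 3))

/-- Local notation: division by the weight. -/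
local notation:max "𝐜" x:max => (fun mm : ℤ × (Fin 3 → ℤ) =>
  ((((|((Prod.fst mm : ℤ) : ℝ)| + freqNormSq (Prod.snd mm))⁻¹ : ℝ) : ℂ) • x mm))

/-- Local notation: multiplication by the weight. -/
local notation:max "𝐬" x:max => (fun mm : ℤ × (Fin 3 → ℤ) =>
  ((((|((Prod.fst mm : ℤ) : ℝ)| + freqNormSq (Prod.snd mm)) : ℝ) : ℂ) • x mm))

/-- Local notation: the family of coefficients of `x ∈ W ⊂ ℓ²`. -/
local notation:max "𝐰" x:max =>
  (((x : lp (fun _ : ℤ × (Fin 3 → ℤ) => EuclideanSpace ℂ (Fin 3)) 2)) : ℤ × (Fin 3 → ℤ) → EuclideanSpace ℂ (Fin 3))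

/-- Local notation: the symbol `σ_om(n,k) = 2πi om n + 4π²ν|k|² + 2πi m₀·k`. -/
local notation "σ[" om ", " ν ", " m₀ "]" => (fun mm : ℤ × (Fin 3 → ℤ) =>
  2 * Real.pi * Complex.I * ((om : ℝ) : ℂ) * ((Prod.fst mm : ℤ) : ℂ) +
    (((4 * Real.pi ^ 2 * ν * freqNormSq (Prod.snd mm) : ℝ)) : ℂ) +
    2 * Real.pi * Complex.I * (∑ jj : Fin 3, ((m₀ jj : ℝ) : ℂ) * (((Prod.snd mm) jj : ℤ) : ℂ)))

/-- Local notation: the lattice family of the orbit `u` with period `τ`: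
`û(n,k) = 𝓕(complexify ∘ (timeRoll τ u − ∫ u(0)))(n,k)`. -/
local notation:max "𝐨[" τ ", " u "]" => (fun mm : ℤ × (Fin 3 → ℤ) =>
  mFourierCoeff (EuclideanSpace.complexify ∘ fun y : UnitAddTorus (Fin 4) => Torus.timeRoll τ u y - ∫ x, u 0 x)
    (Fin.cons (Prod.fst mm) (Prod.snd mm) : Fin 4 → ℤ))

/-- Local notation: the force family `y_F(n,k) = [k ≠ 0][n = 0] 𝓕(complexify ∘ F)(k)`. -/
local notation:max "𝐲" F:max => (fun mm : ℤ × (Fin 3 → ℤ) =>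
  (ite (Prod.snd mm = 0) (0 : EuclideanSpace ℂ (Fin 3))
    (ite (Prod.fst mm = 0) (mFourierCoeff (EuclideanSpace.complexify ∘ F) (Prod.snd mm)) 0)))

/-- Local notation: the family of coefficients of an element of `ℓ²(ℤ × ℤ³; ℂ³)`. -/
local notation:max "𝐯" x:max =>
  ((x : lp (fun _ : ℤ × (Fin 3 → ℤ) => EuclideanSpace ℂ (Fin 3)) 2) : ℤ × (Fin 3 → ℤ) → EuclideanSpace ℂ (Fin 3))

/-- Local notation: the BUDGET-FREE LATTICE-TEMPERED CORRESPONDENCE of the window `n` — to a coefficient vector `c` the set of data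
`(ν, τ, m, x)` (viscosity, period, mean, weighted lattice state `x = Λû ∈ ℓ²`) of the classical time-periodic solutions of `NS_ν(f_c)`
with `ν, τ ∈ [1/(n+1), n+1]`, `‖m‖ ≤ n+1`, `Σ Λ‖x‖² ≤ n+1`. -/
local notation "𝚽[" S ", " n "]" => (fun c : Coeff S => setOf
  (fun q : ℝ × ℝ × (EuclideanSpace ℝ (Fin 3) × lp (fun _ : ℤ × (Fin 3 → ℤ) => EuclideanSpace ℂ (Fin 3)) 2) =>
    1 / ((n : ℝ) + 1) ≤ (Prod.fst q) ∧ (Prod.fst q) ≤ (n : ℝ) + 1 ∧ 1 / ((n : ℝ) + 1) ≤ (Prod.fst (Prod.snd q)) ∧ (Prod.fst (Prod.snd q)) ≤ (n : ℝ) + 1 ∧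
    ‖(Prod.fst (Prod.snd (Prod.snd q)))‖ ≤ (n : ℝ) + 1 ∧
    (∑' mm : ℤ × (Fin 3 → ℤ), ENNReal.ofReal (Λ mm) * ‖(𝐯 ((Prod.snd (Prod.snd (Prod.snd q))))) mm‖ₑ ^ 2) ≤ ENNReal.ofReal ((n : ℝ) + 1) ∧
    ∃ (u : ℝ → UnitAddTorus (Fin 3) → EuclideanSpace ℝ (Fin 3)) (p : ℝ → UnitAddTorus (Fin 3) → ℝ),
      IsClassicalNSSolutionOn Set.univ (Prod.fst q) (fun _ => force S c) u p ∧ Function.Periodic u (Prod.fst (Prod.snd q)) ∧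
      (∫ y, u 0 y) = (Prod.fst (Prod.snd (Prod.snd q))) ∧ 𝐯 ((Prod.snd (Prod.snd (Prod.snd q)))) = 𝐬 𝐨[(Prod.fst (Prod.snd q)), u]))
-- NOTATION END

/-! ## §0 Lattice-tempered windows -/

/-- **Lattice-tempered window** `LOUD^K(S,E,ε)`: coefficient vectors carrying a classical time-periodic witness
whose viscosity lies in `[ν₁,ν₂]`, period in `[τ₁,τ₂]`, mean velocity in the closed ball of radius `H`, and whose
space–time lattice data `û = 𝓕(timeRoll τ u − mean)` has parabolic moment `Σ Λ³‖û‖² ≤ H`, with (closed) budgets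
`meanEnergy ≤ E`, `meanDissipation ≥ ε`. [folklore] -/
def loudWin (S : Finset (Fin 3 → ℤ)) (ν₁ ν₂ τ₁ τ₂ H E ε : ℝ) : Set (Coeff S) :=
  {c | ∃ ν : ℝ, ν₁ ≤ ν ∧ ν ≤ ν₂ ∧ ∃ (τ : ℝ) (u : ℝ → 𝕋³ → ℝ³) (p : ℝ → 𝕋³ → ℝ), τ₁ ≤ τ ∧ τ ≤ τ₂ ∧
    IsClassicalNSSolutionOn Set.univ ν (fun _ => force S c) u p ∧ Function.Periodic u τ ∧
    ‖∫ x, u 0 x‖ ≤ H ∧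
    (∑' m : ℤ × (Fin 3 → ℤ), ENNReal.ofReal ((Λ m) ^ 3) * ‖𝐨[τ, u] m‖ₑ ^ 2) ≤ ENNReal.ofReal H ∧
    meanEnergy u ≤ E ∧ ε ≤ meanDissipation ν u}

/-- The `n`-th standard lattice-tempered window inside the viscosity ceiling `a`:
`ν ∈ [a/(n+2), a(n+1)/(n+2)]`, `τ ∈ [1/(n+1), n+1]`, `H = n+1`. [folklore] -/
def win (S : Finset (Fin 3 → ℤ)) (a E ε : ℝ) (n : ℕ) : Set (Coeff S) :=
  loudWin S (a / ((n : ℝ) + 2)) (a * ((n : ℝ) + 1) / ((n : ℝ) + 2)) (1 / ((n : ℝ) + 1)) ((n : ℝ) + 1)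
    ((n : ℝ) + 1) E ε

/-- A standard window sits inside the loud set of its ceiling. [folklore] -/
theorem win_subset_loud {S : Finset (Fin 3 → ℤ)} {a E ε : ℝ} (ha : 0 < a) (n : ℕ) :
    win S a E ε n ⊆ loud S a E ε := by
  rintro c ⟨ν, hν₁, hν₂, τ, u, p, hτ₁, _hτ₂, hsol, hper, _hm, _hH, hE, hε⟩
  have hn2 : (0 : ℝ) < (n : ℝ) + 2 := by positivity
  have hn1 : (0 : ℝ) < (n : ℝ) + 1 := by positivity
  refine ⟨ν, ?_, ?_, τ, u, p, ?_, hsol, hper, hE, hε⟩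
  · exact lt_of_lt_of_le (div_pos ha hn2) hν₁
  · have : a * ((n : ℝ) + 1) / ((n : ℝ) + 2) < a := by
      rw [div_lt_iff₀ hn2]; nlinarith
    exact lt_of_le_of_lt hν₂ this
  · exact lt_of_lt_of_le (one_div_pos.2 hn1) hτ₁

/-! ## §1 Sub₀ — window exhaustion (registered stub `stub_windowExhaust`, LANDED p161161: `…StubWindowExhaust.lean`) -/

/-- **Sub₀**: the loud set of ceiling `a > 0` is exhausted by its standard windows. [folklore] -/
theorem windowExhaust (S : Finset (Fin 3 → ℤ)) (a E ε : ℝ) :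
    loud S a E ε ⊆ ⋃ n : ℕ, win S a E ε n := by
  rintro c ⟨ν, hν, hνa, τ, u, p, hτ, hsol, hper, hE, hε⟩
  obtain ⟨n, h1, h2, h3, h4, h5, h6⟩ := stub_windowExhaust S a c ν τ u p hν hνa hτ hsol hper
  exact Set.mem_iUnion.2 ⟨n, ν, h1, h2, τ, u, p, h3, h4, hsol, hper, h5, h6, hE, hε⟩

/-! ## §2 Sub₁ — tempered windows are closed (four registered analytic stubs LANDED: `stub_orbitInW` p161083,
`stub_limitEquation` p161385, `stub_realizeTempered` p161460, `stub_budgetLimit` p161396; assembly LANDED p162128) -/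

/-- **stub_temperedClosed** (Sub₁ of census D5 — LATTICE-TEMPERED WINDOWS ARE CLOSED; LANDED as `Tempered.isClosed_latticeWindow`,
p162128 `…RobustLoudUpgradeTemperedClosed.lean` — the lead's assembly of the four landed stubs — and read here through `loudWin` by
definitional unfolding): for a sequence `cᵢ → c` in the window extract convergent viscosities, periods, means (compact intervals/ball) and a
NORM-convergent subsequence of the states `xᵢ = Λûᵢ ∈ W` (`isCompact_wt_le`: the window's moment bound is `Σ Λ‖xᵢ‖² ≤ H`);
pass the lattice equation to the limit (`stub_limitEquation`), realize the limit as a classical periodic orbit of `f_c` with the limit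
lattice data (`stub_realizeTempered`), and read off window membership (moment by closedness of the compact set, budgets by
`stub_budgetLimit`). [folklore] -/
theorem stub_temperedClosed : ∀ (S : Finset (Fin 3 → ℤ)) (ν₁ ν₂ τ₁ τ₂ H E ε : ℝ), 0 < ν₁ → 0 < τ₁ →
    IsClosed (loudWin S ν₁ ν₂ τ₁ τ₂ H E ε) :=
  isClosed_latticeWindow


/-! ## §3 Sub₂ — the residual (registered; ≡ the crux in Baire-largeness language, census D5) -/

/-- **stub_residual_c16** (Sub₂ `LocallyNonMeagreLoud`: RELAXED LOUDNESS IS OF SECOND CATEGORY NEAR EVERY LOUD FORCE).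
Crux-hard: it is implied by the crux with no input (`locallyNonMeagreLoud_of_crux`, a non-empty open subset of the
Baire space `P_S` is not meagre) and implies it given Sub₀ + Sub₁ (below).  Registered as the honest residual of the
reshape c16; its mean-zero/any-mean STEADY part is meagre-small by the c15 category package. [folklore] -/
theorem stub_residual_c16 :
    ∃ S₀ : Finset (Fin 3 → ℤ), ∀ S : Finset (Fin 3 → ℤ), S₀ ⊆ S → ∀ (E ε : ℝ), 0 < ε → ∀ j : ℕ,
      ∀ c ∈ loud S (1 / ((j : ℝ) + 1)) E ε, ∀ V : Set (Coeff S), IsOpen V → c ∈ V →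
        ¬ IsMeagre (loud S (1 / ((j : ℝ) + 1)) (2 * E) (ε / 2) ∩ V) := by
  sorry

/-! ## §5 (cycle 2) GENERIC PERSISTENCE FOR ALL WITNESSES — the periodic twin of the c15 `CategoryGeneric` package.
Registered stubs of wave 2 (`stub_corrRange`, `stub_corrGraphClosed`, `stub_windowExhaust2`, `stub_lhcInterior`) and the lead's
assembly `stub_genericPeriodic` (Fort's theorem on the compact corestriction, window by window).  None of this feeds the composition
(the residual is unchanged); it lands `--supports`. -/

section Generic

/-- **stub_genericPeriodic** (GENERIC ROBUSTNESS OF ALL LOUD WITNESSES; lead's assembly of wave 2, def-free existential form): for every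
frequency family `S` there is a RESIDUAL set `G ⊆ P_S` of forces — the common lower-hemicontinuity points of the budget-free correspondences
`𝚽[S,n]` (Fort's theorem on their compact corestrictions, `stub_corrRange` + `stub_corrGraphClosed` ⇒ upper hemicontinuity) — such that
for ALL ceilings `a` and budgets `E, ε`: every `c ∈ G` carrying a classical time-periodic solution of `NS_ν(f_c)` at some `ν ∈ (0,a)` (any
mean, any period) with `meanEnergy < E` and `meanDissipation > ε` is an INTERIOR point of `loud S a E ε` (`stub_windowExhaust2` +
`stub_lhcInterior`). [folklore] -/
theorem stub_genericPeriodic : ∀ (S : Finset (Fin 3 → ℤ)), ∃ G : Set (Coeff S), G ∈ residual (Coeff S) ∧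
    ∀ (a E ε : ℝ) (c : Coeff S), c ∈ G → ∀ (ν τ : ℝ) (u : ℝ → 𝕋³ → ℝ³) (p : ℝ → 𝕋³ → ℝ), 0 < ν → ν < a → 0 < τ →
      IsClassicalNSSolutionOn Set.univ ν (fun _ => force S c) u p → Function.Periodic u τ →
        meanEnergy u < E → ε < meanDissipation ν u → c ∈ interior (loud S a E ε) := by
  intro S
  refine ⟨⋂ n : ℕ, {c | LowerHemicontinuousAt 𝚽[S, n] c}, ?_, ?_⟩
  · refine (countable_iInter_mem (ι := ℕ)).2 fun n => ?_
    -- the correspondence of the window `n` is upper hemicontinuous: closed graph into one compact set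
    obtain ⟨K, hK, hΦK⟩ := stub_corrRange S n
    have hgraph := stub_corrGraphClosed S n
    have huhc : UpperHemicontinuous 𝚽[S, n] := by
      refine upperHemicontinuous_iff.2 fun c₀ => ?_
      refine UpperHemicontinuousAt.of_sequences hK.isSeqCompact (Eventually.of_forall fun c => hΦK c) ?_
      intro cs hcs qs hqs q₀ hq
      have hmem : (c₀, q₀) ∈ {cq : Coeff S × (ℝ × ℝ × (EuclideanSpace ℝ (Fin 3) ×
          lp (fun _ : ℤ × (Fin 3 → ℤ) => EuclideanSpace ℂ (Fin 3)) 2)) | cq.2 ∈ 𝚽[S, n] cq.1} :=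
        hgraph.mem_of_tendsto (hcs.prodMk_nhds hq) (Eventually.of_forall fun i => hqs i)
      exact hmem
    -- Fort's theorem on the compact corestriction (a compact metric space is second countable and regular)
    haveI : CompactSpace K := isCompact_iff_compactSpace.mp hK
    haveI : SecondCountableTopology K := EMetric.secondCountable_of_sigmaCompact K
    have hrange : IsClosed (Set.range (Subtype.val : K → ℝ × ℝ × (EuclideanSpace ℝ (Fin 3) ×
        lp (fun _ : ℤ × (Fin 3 → ℤ) => EuclideanSpace ℂ (Fin 3)) 2))) := by
      rw [Subtype.range_coe]; exact hK.isClosed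
    have huhc' : UpperHemicontinuous (fun c : Coeff S => (Subtype.val : K → _) ⁻¹' (𝚽[S, n] c)) :=
      huhc.isInducing_comp Topology.IsInducing.subtypeVal hrange
    have hmeagre : IsMeagre {c : Coeff S | ¬ LowerHemicontinuousAt (fun c : Coeff S => (Subtype.val : K → _) ⁻¹' (𝚽[S, n] c)) c} :=
      Literature.Topology.isMeagre_setOf_not_lowerHemicontinuousAt huhc'
    -- lower hemicontinuity descends from the corestriction
    have htrans : ∀ c : Coeff S, LowerHemicontinuousAt (fun c : Coeff S => (Subtype.val : K → _) ⁻¹' (𝚽[S, n] c)) c →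
        LowerHemicontinuousAt 𝚽[S, n] c := by
      intro c h
      rw [lowerHemicontinuousAt_iff] at h ⊢
      intro U hU hne
      obtain ⟨q, hqΦ, hqU⟩ := hne
      have h' := h (Subtype.val ⁻¹' U) (hU.preimage continuous_subtype_val) ⟨⟨q, hΦK c hqΦ⟩, hqΦ, hqU⟩
      exact h'.mono fun c' ⟨q', hq'Φ, hq'U⟩ => ⟨q'.1, hq'Φ, hq'U⟩
    exact Filter.mem_of_superset hmeagre fun c hc => htrans c (not_not.1 hc)
  · intro a E ε c hc ν τ u p hν hνa hτ hsol hper hE hD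
    obtain ⟨n, x, hmem, hx⟩ := stub_windowExhaust2 S c ν τ u p hν hτ hsol hper
    exact stub_lhcInterior S n a E ε c (Set.mem_iInter.1 hc n) ν τ u p x hν hνa hτ hsol hper hmem hx hE hD

end Generic

/-! ## §4 Composition (sorry-free): the crux BY NAME -/

/-- **The relaxed loud set is `F_σ`**: it is the countable union of its CLOSED standard windows (Sub₀ + Sub₁). [folklore] -/
theorem loud_eq_iUnion_win (S : Finset (Fin 3 → ℤ)) {a : ℝ} (E ε : ℝ) (ha : 0 < a) :
    loud S a E ε = ⋃ n : ℕ, win S a E ε n :=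
  Set.Subset.antisymm (windowExhaust S a E ε) (Set.iUnion_subset fun n => win_subset_loud ha n)

/-- Standard windows are closed (Sub₁ at the standard parameters). [folklore] -/
theorem isClosed_win (S : Finset (Fin 3 → ℤ)) {a : ℝ} (E ε : ℝ) (ha : 0 < a) (n : ℕ) :
    IsClosed (win S a E ε n) :=
  stub_temperedClosed S _ _ _ _ _ _ _ (div_pos ha (by positivity)) (one_div_pos.2 (by positivity))

/-- **Composition (lead c16): Sub₁ (closed windows) + Sub₀ (exhaustion) + Sub₂ (local non-meagreness) prove the crux
`RobustLoudUpgrade` BY NAME.** [folklore] -/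
theorem RobustLoudUpgrade_of : RobustLoudUpgrade := by
  obtain ⟨S₀, hS₀⟩ := stub_residual_c16
  refine ⟨S₀, fun S hS E ε hε j c hc => ?_⟩
  have ha : (0 : ℝ) < 1 / ((j : ℝ) + 1) := one_div_pos.2 (by positivity)
  exact mem_closure_interior_of_not_isMeagre (isClosed_win S (2 * E) (ε / 2) ha)
    (loud_eq_iUnion_win S (2 * E) (ε / 2) ha) (hS₀ S hS E ε hε j c hc)

end Summit.AnomalousDissipation.AnomalousDissipation.Theorems.RobustLoudUpgrade.Tempered

end
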